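import Literature.Probability.LatticeModels.GibbsSpecificationDLRProofs
import HarnessLib

/-!
# The strong Markov property of Gibbs measures for random volumes determined from outside

Topic `Probability/LatticeModels`, generic specifications `γ : Specification V S`; theorems
only. Georgii–Higuchi 2000, §2 (p. 3): "the strong Markov property of Gibbs measures, stating
that `μ(·|𝓕_{Γᶜ})(ω) = μ^ω_{Γ(ω)}` for `μ`-almost all `ω` when `Γ` is any finite random subset of
`ℤ²` which is determined from outside, in that `{Γ = Λ} ∈ 𝓕_{Λᶜ}` for all finite `Λ` … For a
proof one simply splits `Ω` into the disjoint sets `{Γ = Λ}` for finite `Λ`." This file proves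
the integrated forms of that statement which the percolation arguments consume:

* `IsGibbsMeasure.restrict_bind_spec` — DLR with a frozen outside event: for `B ∈ 𝓕_{Λᶜ}`,
  `(μ|_B) γ_Λ = μ|_B`; hence `∫_B γ_Λ(f) dμ = ∫_B f dμ` for measurable `f ≥ 0`
  (`setLIntegral_lintegral_spec`) and for bounded measurable real `f` (`setIntegral_integral_spec`).
* **`IsGibbsMeasure.lintegral_strongMarkov`**, **`IsGibbsMeasure.integral_strongMarkov`** — for
  a random finite volume `Γ : (V → S) → Finset V` determined from outside and measurable
  `f ≥ 0` (resp. bounded measurable real `f`): `∫ f dμ = ∫ (∫ f dγ_{Γ(ω)}(·|ω)) μ(dω)`, and the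
  localised form `∫_{Γ ∈ 𝒜} f dμ = ∫_{Γ ∈ 𝒜} γ_{Γ(ω)}(f|ω) μ(dω)` for any family `𝒜` of volumes
  (`setLIntegral_strongMarkov`), e.g. `𝒜 = {Λ | Λ ≠ ∅}` as in Georgii–Higuchi's
  `μ(f) ≥ μ(μ^·_Γ(f) 1_{Γ ≠ ∅})`.

## References

* H.-O. Georgii, Y. Higuchi, J. Math. Phys. 41 (2000) 1153–1169, §2, p. 3 [GeorgiiHiguchi2000].
* H.-O. Georgii, *Gibbs Measures and Phase Transitions*, 2nd ed. 2011, Rem. 1.24 [Georgii2011].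
-/

noncomputable section

open MeasureTheory ProbabilityTheory
open scoped ENNReal ProbabilityTheory

namespace Literature.Probability.LatticeModels

variable {V S : Type*} [MeasurableSpace S] {γ : Specification V S} {μ : Measure (V → S)}

namespace IsGibbsMeasure

/-! ### DLR equations with a frozen outside event -/

/-- **DLR with a frozen outside event**: for `μ ∈ 𝒢(γ)` and `B ∈ 𝓕_{Λᶜ}`, `(μ|_B) γ_Λ = μ|_B`,
i.e. `∫_B γ_Λ(A|·) dμ = μ(A ∩ B)` for all events `A` (properness and the DLR equation;
Georgii 2011, Rem. 1.24 with Rem. 1.20). [cite: Georgii2011, Def. 1.23 / Rem. 1.24] -/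
theorem restrict_bind_spec (hγ : IsSpecification γ) (hμ : IsGibbsMeasure γ μ) (Λ : Finset V)
    {B : Set (V → S)} (hB : MeasurableSet[cylinderEvents (X := fun _ : V => S) ((↑Λ : Set V)ᶜ)] B) :
    (μ.restrict B).bind (γ Λ) = μ.restrict B := by
  have hBm : MeasurableSet B := cylinderEvents_le_pi _ hB
  ext A hA
  rw [Measure.bind_apply hA (hγ.measurable_fun Λ).aemeasurable, Measure.restrict_apply hA]
  have hind : ∀ η, B.indicator (fun η => γ Λ η A) η = γ Λ η (A ∩ B) := by
    intro η
    rw [hγ.measure_inter_of_cylinderEvents Λ A hB η]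
    by_cases hη : η ∈ B
    · simp [Set.indicator_of_mem hη]
    · simp [Set.indicator_of_notMem hη]
  rw [← lintegral_indicator hBm]
  simp_rw [hind]
  exact hμ.2 Λ (A ∩ B) (hA.inter hBm)

/-- For `μ ∈ 𝒢(γ)`, `B ∈ 𝓕_{Λᶜ}` and measurable `f ≥ 0`: `∫_B (∫ f dγ_Λ(·|ω)) μ(dω) = ∫_B f dμ`
(Georgii 2011, Rem. 1.24). [cite: Georgii2011, Def. 1.23 / Rem. 1.24] -/
theorem setLIntegral_lintegral_spec (hγ : IsSpecification γ) (hμ : IsGibbsMeasure γ μ)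
    (Λ : Finset V) {B : Set (V → S)}
    (hB : MeasurableSet[cylinderEvents (X := fun _ : V => S) ((↑Λ : Set V)ᶜ)] B)
    {f : (V → S) → ℝ≥0∞} (hf : Measurable f) :
    ∫⁻ ω in B, ∫⁻ σ, f σ ∂(γ Λ ω) ∂μ = ∫⁻ ω in B, f ω ∂μ := by
  rw [← Measure.lintegral_bind (hγ.measurable_fun Λ).aemeasurable hf.aemeasurable,
    hμ.restrict_bind_spec hγ Λ hB]

/-- For `μ ∈ 𝒢(γ)`, `B ∈ 𝓕_{Λᶜ}` and bounded measurable real `f`: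
`∫_B (∫ f dγ_Λ(·|ω)) μ(dω) = ∫_B f dμ` (Georgii 2011, Rem. 1.24; the conditional expectation
`μ(f|𝓕_{Λᶜ}) = γ_Λ f` integrated over `B`). [cite: Georgii2011, Def. 1.23 / Rem. 1.24] -/
theorem setIntegral_integral_spec (hγ : IsSpecification γ) (hμ : IsGibbsMeasure γ μ)
    (Λ : Finset V) {B : Set (V → S)}
    (hB : MeasurableSet[cylinderEvents (X := fun _ : V => S) ((↑Λ : Set V)ᶜ)] B)
    {f : (V → S) → ℝ} (hf : Measurable f) {C : ℝ} (hC : ∀ σ, |f σ| ≤ C) :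
    ∫ ω in B, ∫ σ, f σ ∂(γ Λ ω) ∂μ = ∫ ω in B, f ω ∂μ := by
  haveI := hμ.isProbabilityMeasure
  have hf_int : Integrable f μ := (integrable_const C).mono' hf.aestronglyMeasurable
    (ae_of_all _ fun σ => by rw [Real.norm_eq_abs]; exact hC σ)
  rw [← setIntegral_condExp (m := cylinderEvents (X := fun _ : V => S) ((↑Λ : Set V)ᶜ))
    cylinderEvents_le_pi hf_int hB]
  exact (setIntegral_congr_ae (cylinderEvents_le_pi _ hB)
    ((hμ.condExp_ae_eq_integral hγ Λ hf hC).mono fun ω hω _ => hω)).symm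

/-! ### Random volumes determined from outside -/

variable [Countable V]

/-- For a random finite volume `Γ` with measurable level sets and measurable `g ≥ 0`, the
function `ω ↦ ∫ g dγ_{Γ(ω)}(·|ω)` is measurable (it is `∫ g dγ_Λ(·|ω)` on `{Γ = Λ}`, a countable
measurable partition) (Georgii–Higuchi 2000, §2, p. 3). [cite: GeorgiiHiguchi2000, §2 p. 3] -/
theorem _root_.Literature.Probability.LatticeModels.IsSpecification.measurable_lintegral_randomVolume
    (hγ : IsSpecification γ) {Γ : (V → S) → Finset V}
    (hΓm : ∀ Λ : Finset V, MeasurableSet {ω | Γ ω = Λ}) {g : (V → S) → ℝ≥0∞} (hg : Measurable g) :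
    Measurable fun ω => ∫⁻ σ, g σ ∂(γ (Γ ω) ω) := by
  classical
  have hpiece : ∀ Λ : Finset V, Measurable fun ω => ∫⁻ σ, g σ ∂(γ Λ ω) := by
    intro Λ
    let κ : Kernel (V → S) (V → S) := ⟨γ Λ, hγ.measurable_fun Λ⟩
    haveI : IsMarkovKernel κ := ⟨fun η => hγ.isProbability Λ η⟩
    exact hg.lintegral_kernel (κ := κ)
  have hFsum : (fun ω => ∫⁻ σ, g σ ∂(γ (Γ ω) ω)) = fun ω => ∑' Λ : Finset V,
      {ω | Γ ω = Λ}.indicator (fun ω => ∫⁻ σ, g σ ∂(γ Λ ω)) ω := by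
    funext ω
    rw [tsum_eq_single (Γ ω)]
    · simp
    · intro Λ hΛ
      rw [Set.indicator_of_notMem (show ω ∉ {ω | Γ ω = Λ} from fun h => hΛ (Eq.symm h))]
  rw [hFsum]
  exact Measurable.tsum fun Λ => (hpiece Λ).indicator (hΓm Λ)

/-- **Strong Markov property, localised `ℝ≥0∞` form** (Georgii–Higuchi 2000, §2, p. 3). Let
`μ ∈ 𝒢(γ)` and let `Γ` be a random finite volume determined from outside
(`{Γ = Λ} ∈ 𝓕_{Λᶜ}` for every `Λ`). Then for every family `𝒜` of volumes and measurable `f ≥ 0`,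
`∫_{Γ ∈ 𝒜} f dμ = ∫_{Γ ∈ 𝒜} (∫ f dγ_{Γ(ω)}(·|ω)) μ(dω)`: split `{Γ ∈ 𝒜}` into the events
`{Γ = Λ}`, `Λ ∈ 𝒜`, and use DLR with the frozen outside event `{Γ = Λ}`. [cite: GeorgiiHiguchi2000, §2 p. 3] -/
theorem setLIntegral_strongMarkov (hγ : IsSpecification γ) (hμ : IsGibbsMeasure γ μ)
    {Γ : (V → S) → Finset V}
    (hΓ : ∀ Λ : Finset V, MeasurableSet[cylinderEvents (X := fun _ : V => S) ((↑Λ : Set V)ᶜ)]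
      {ω | Γ ω = Λ})
    (𝒜 : Set (Finset V)) {f : (V → S) → ℝ≥0∞} (hf : Measurable f) :
    ∫⁻ ω in {ω | Γ ω ∈ 𝒜}, f ω ∂μ =
      ∫⁻ ω in {ω | Γ ω ∈ 𝒜}, ∫⁻ σ, f σ ∂(γ (Γ ω) ω) ∂μ := by
  classical
  have hΓm : ∀ Λ, MeasurableSet {ω | Γ ω = Λ} := fun Λ => cylinderEvents_le_pi _ (hΓ Λ)
  -- the partition `{Γ ∈ 𝒜} = ⋃_{Λ ∈ 𝒜} {Γ = Λ}`
  let s : Finset V → Set (V → S) := fun Λ => if Λ ∈ 𝒜 then {ω | Γ ω = Λ} else ∅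
  have hsm : ∀ Λ, MeasurableSet (s Λ) := fun Λ => by
    by_cases h : Λ ∈ 𝒜 <;> simp [s, h, hΓm]
  have hsd : Pairwise (Function.onFun Disjoint s) := by
    intro Λ Λ' hne
    refine Set.disjoint_left.2 fun ω hω hω' => hne ?_
    by_cases h : Λ ∈ 𝒜 <;> by_cases h' : Λ' ∈ 𝒜 <;> simp [s, h, h'] at hω hω'
    exact hω.symm.trans hω'
  have hU : {ω | Γ ω ∈ 𝒜} = ⋃ Λ, s Λ := by
    ext ω
    simp only [Set.mem_setOf_eq, Set.mem_iUnion]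
    constructor
    · intro h
      exact ⟨Γ ω, by simp [s, h]⟩
    · rintro ⟨Λ, hΛ⟩
      by_cases h : Λ ∈ 𝒜
      · simp only [s, if_pos h, Set.mem_setOf_eq] at hΛ
        rwa [hΛ]
      · simp [s, h] at hΛ
  -- both sides split along the partition; the pieces agree by DLR with frozen outside event
  rw [hU, lintegral_iUnion hsm hsd, lintegral_iUnion hsm hsd]
  refine tsum_congr fun Λ => ?_
  by_cases hΛ : Λ ∈ 𝒜
  · simp only [s, if_pos hΛ]
    rw [← hμ.setLIntegral_lintegral_spec hγ Λ (hΓ Λ) hf]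
    refine setLIntegral_congr_fun (hΓm Λ) fun ω hω => ?_
    simp only [Set.mem_setOf_eq] at hω
    simp [hω]
  · simp [s, hΛ]

/-- **Strong Markov property, `ℝ≥0∞` form** (Georgii–Higuchi 2000, §2, p. 3): for `μ ∈ 𝒢(γ)`, a
random finite volume `Γ` determined from outside and measurable `f ≥ 0`,
`∫ f dμ = ∫ (∫ f dγ_{Γ(ω)}(·|ω)) μ(dω)`. [cite: GeorgiiHiguchi2000, §2 p. 3] -/
theorem lintegral_strongMarkov (hγ : IsSpecification γ) (hμ : IsGibbsMeasure γ μ)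
    {Γ : (V → S) → Finset V}
    (hΓ : ∀ Λ : Finset V, MeasurableSet[cylinderEvents (X := fun _ : V => S) ((↑Λ : Set V)ᶜ)]
      {ω | Γ ω = Λ})
    {f : (V → S) → ℝ≥0∞} (hf : Measurable f) :
    ∫⁻ ω, f ω ∂μ = ∫⁻ ω, ∫⁻ σ, f σ ∂(γ (Γ ω) ω) ∂μ := by
  have h := hμ.setLIntegral_strongMarkov hγ hΓ Set.univ hf
  simpa using h

/-- **Strong Markov property for events** (Georgii–Higuchi 2000, §2, p. 3): for `μ ∈ 𝒢(γ)`, a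
random finite volume `Γ` determined from outside, a family `𝒜` of volumes and an event `A`,
`μ(A ∩ {Γ ∈ 𝒜}) = ∫_{Γ ∈ 𝒜} γ_{Γ(ω)}(A|ω) μ(dω)`. [cite: GeorgiiHiguchi2000, §2 p. 3] -/
theorem measure_inter_strongMarkov (hγ : IsSpecification γ) (hμ : IsGibbsMeasure γ μ)
    {Γ : (V → S) → Finset V}
    (hΓ : ∀ Λ : Finset V, MeasurableSet[cylinderEvents (X := fun _ : V => S) ((↑Λ : Set V)ᶜ)]
      {ω | Γ ω = Λ})
    (𝒜 : Set (Finset V)) {A : Set (V → S)} (hA : MeasurableSet A) :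
    μ (A ∩ {ω | Γ ω ∈ 𝒜}) = ∫⁻ ω in {ω | Γ ω ∈ 𝒜}, γ (Γ ω) ω A ∂μ := by
  have h := hμ.setLIntegral_strongMarkov hγ hΓ 𝒜 (measurable_one.indicator hA)
  simp_rw [lintegral_indicator_one hA] at h
  rw [← h, Measure.restrict_apply hA]

/-- **Strong Markov property, real form** (Georgii–Higuchi 2000, §2, p. 3): for `μ ∈ 𝒢(γ)`, a
random finite volume `Γ` determined from outside and bounded measurable real `f`,
`∫ f dμ = ∫ (∫ f dγ_{Γ(ω)}(·|ω)) μ(dω)` (reduced to the `ℝ≥0∞` form by the shift `f + C ≥ 0`). [cite: GeorgiiHiguchi2000, §2 p. 3] -/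
theorem integral_strongMarkov (hγ : IsSpecification γ) (hμ : IsGibbsMeasure γ μ)
    {Γ : (V → S) → Finset V}
    (hΓ : ∀ Λ : Finset V, MeasurableSet[cylinderEvents (X := fun _ : V => S) ((↑Λ : Set V)ᶜ)]
      {ω | Γ ω = Λ})
    {f : (V → S) → ℝ} (hf : Measurable f) {C : ℝ} (hC : ∀ σ, |f σ| ≤ C) :
    ∫ ω, f ω ∂μ = ∫ ω, ∫ σ, f σ ∂(γ (Γ ω) ω) ∂μ := by
  haveI := hμ.isProbabilityMeasure
  have hΓm : ∀ Λ, MeasurableSet {ω | Γ ω = Λ} := fun Λ => cylinderEvents_le_pi _ (hΓ Λ)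
  have hprob : ∀ ω, IsProbabilityMeasure (γ (Γ ω) ω) := fun ω => hγ.isProbability _ ω
  -- the shifted nonnegative function `g = f + C` and its `ℝ≥0∞` version
  have hC0 : ∀ σ, 0 ≤ f σ + C := fun σ => by linarith [neg_abs_le (f σ), hC σ]
  set g : (V → S) → ℝ≥0∞ := fun σ => ENNReal.ofReal (f σ + C) with hg
  have hgm : Measurable g := (hf.add_const C).ennreal_ofReal
  have hg_le : ∀ σ, g σ ≤ ENNReal.ofReal (C + C) := fun σ =>
    ENNReal.ofReal_le_ofReal (by linarith [le_abs_self (f σ), hC σ])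
  -- `∫ f dν + C = (∫⁻ g dν).toReal` for every probability measure `ν`
  have hshift : ∀ (ν : Measure (V → S)) [IsProbabilityMeasure ν],
      ∫ σ, f σ ∂ν + C = (∫⁻ σ, g σ ∂ν).toReal := by
    intro ν _
    have hfi : Integrable f ν := (integrable_const C).mono' hf.aestronglyMeasurable
      (ae_of_all _ fun σ => by rw [Real.norm_eq_abs]; exact hC σ)
    have h1 : ∫ σ, f σ + C ∂ν = ∫ σ, f σ ∂ν + C := by
      rw [integral_add hfi (integrable_const C), integral_const, smul_eq_mul, probReal_univ,
        one_mul]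
    rw [← h1, integral_eq_lintegral_of_nonneg_ae (ae_of_all _ hC0)
      (hf.add_const C).aestronglyMeasurable]
  -- the right-hand integrand and its finiteness
  have hGm : Measurable fun ω => ∫⁻ σ, g σ ∂(γ (Γ ω) ω) :=
    hγ.measurable_lintegral_randomVolume hΓm hgm
  have hG_le : ∀ ω, ∫⁻ σ, g σ ∂(γ (Γ ω) ω) ≤ ENNReal.ofReal (C + C) := fun ω => by
    haveI := hprob ω
    calc ∫⁻ σ, g σ ∂(γ (Γ ω) ω) ≤ ∫⁻ _σ, ENNReal.ofReal (C + C) ∂(γ (Γ ω) ω) :=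
          lintegral_mono fun σ => hg_le σ
      _ = ENNReal.ofReal (C + C) := by rw [lintegral_const, measure_univ, mul_one]
  -- assemble
  have key : ∫ ω, f ω ∂μ + C = ∫ ω, (∫ σ, f σ ∂(γ (Γ ω) ω)) ∂μ + C := by
    calc ∫ ω, f ω ∂μ + C = (∫⁻ ω, g ω ∂μ).toReal := hshift μ
      _ = (∫⁻ ω, ∫⁻ σ, g σ ∂(γ (Γ ω) ω) ∂μ).toReal := by
          rw [hμ.lintegral_strongMarkov hγ hΓ hgm]
      _ = ∫ ω, (∫⁻ σ, g σ ∂(γ (Γ ω) ω)).toReal ∂μ :=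
          (integral_toReal hGm.aemeasurable (ae_of_all _ fun ω =>
            (hG_le ω).trans_lt ENNReal.ofReal_lt_top)).symm
      _ = ∫ ω, (∫ σ, f σ ∂(γ (Γ ω) ω) + C) ∂μ := by
          refine integral_congr_ae (ae_of_all _ fun ω => ?_)
          haveI := hprob ω
          exact (hshift (γ (Γ ω) ω)).symm
      _ = ∫ ω, (∫ σ, f σ ∂(γ (Γ ω) ω)) ∂μ + C := by
          have hFm : AEStronglyMeasurable (fun ω => ∫ σ, f σ ∂(γ (Γ ω) ω)) μ := by
            have : (fun ω => ∫ σ, f σ ∂(γ (Γ ω) ω)) =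
                fun ω => (∫⁻ σ, g σ ∂(γ (Γ ω) ω)).toReal - C := by
              funext ω
              haveI := hprob ω
              have := hshift (γ (Γ ω) ω)
              linarith
            rw [this]
            exact (hGm.ennreal_toReal.sub_const C).aestronglyMeasurable
          have hFi : Integrable (fun ω => ∫ σ, f σ ∂(γ (Γ ω) ω)) μ := by
            refine (integrable_const C).mono' hFm (ae_of_all _ fun ω => ?_)
            haveI := hprob ω
            rw [Real.norm_eq_abs]
            have h1 : ‖∫ σ, f σ ∂(γ (Γ ω) ω)‖ ≤ C * (γ (Γ ω) ω).real Set.univ :=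
              norm_integral_le_of_norm_le_const (ae_of_all _ fun σ => by
                rw [Real.norm_eq_abs]; exact hC σ)
            rwa [probReal_univ, mul_one, Real.norm_eq_abs] at h1
          rw [integral_add hFi (integrable_const C), integral_const, smul_eq_mul, probReal_univ,
            one_mul]
  linarith

end IsGibbsMeasure

end Literature.Probability.LatticeModels
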